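import Literature.Geometry.Riemannian.LipschitzSmoothingCompactSupport
import HarnessLib

/-!
# Helper `helper_lipschitzSmoothingCompactSupport` of line `collapsed-ends-usc` (crux
# `EntropyRung.NoncompactShrinkerGap`, stmt-SmoothPoincare4-10868): smoothing of compactly
# supported Lipschitz functions with gradient and support control

Registered helper stub S1 of the κ-noncollapsing programme (Perelman's no local collapsing of a
complete gradient shrinking soliton, brick 2 of route item 16588): the smoothing step of Topping's
test cut-off `ψ(d(x, p)/s)` on a COMPLETE NON-COMPACT manifold. On a Hausdorff, σ-compact manifold
(boundaryless model of finite dimension) with a smooth Riemannian metric `g`, a continuous compactly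
supported `F` with `|F x - F y| ≤ L d_g(x, y)` (in `ℝ≥0∞`) and an open `U ⊇ tsupport F`: for every
`ε > 0` there is a `C^∞` function `χ` with compact support inside `U`, `|χ - F| < ε` and
`|∇χ|²_g ≤ (L + ε)²` everywhere. This is the specialisation to `Type` of the Literature theorem
`Literature.Geometry.Riemannian.exists_contMDiff_approx_of_hasCompactSupport`
(`Literature/Geometry/Riemannian/LipschitzSmoothingCompactSupport.lean`, Azagra–Ferrera–
López-Mesas–Rangel 2007, Thm. 1, compact-support case: finitely many relatively compact chart
domains covering `tsupport F` plus `(tsupport F)ᶜ`, chart mollifications glued by a smooth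
partition of unity). Everything is proved; no definitions.
-/

noncomputable section

-- `Summit.SmoothPoincare4.SmoothPoincare4.…` (summit = problem) trips `dupNamespace` on every decl.
set_option linter.dupNamespace false

open scoped Manifold ContDiff ENNReal NNReal Topology
open Literature.Geometry.Lorentzian Literature.Geometry.Riemannian

namespace Summit.SmoothPoincare4.SmoothPoincare4.Theorems.NoncompactShrinkerGapNoncollapsing

/-- Registered helper `helper_lipschitzSmoothingCompactSupport` (stub S1): smooth approximation of a
compactly supported Lipschitz function with gradient and support control on a (possibly non-compact)
σ-compact manifold — `χ ∈ C^∞_c(U)`, `|χ - F| < ε`, `|∇χ|²_g ≤ (L + ε)²`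
(`exists_contMDiff_approx_of_hasCompactSupport` at universe `Type`).
[cite: AzagraEtAl2007, Thm. 1] -/
theorem helper_lipschitzSmoothingCompactSupport : ∀ {E : Type} [NormedAddCommGroup E] [NormedSpace ℝ E] [FiniteDimensional ℝ E] {H : Type} [TopologicalSpace H] (I : ModelWithCorners ℝ E H) [I.Boundaryless] (M : Type) [TopologicalSpace M] [T2Space M] [LocallyCompactSpace M] [SigmaCompactSpace M] [ChartedSpace H M] [IsManifold I ∞ M] (g : PseudoRiemannianMetric I ∞ E (TangentSpace I : M → Type _)) (hg : g.IsRiemannian) (F : M → ℝ), Continuous F → HasCompactSupport F → ∀ L : ℝ, 0 ≤ L → (∀ x y, ENNReal.ofReal |F x - F y| ≤ ENNReal.ofReal L * g.edist hg x y) → ∀ U : Set M, IsOpen U → tsupport F ⊆ U → ∀ ε : ℝ, 0 < ε → ∃ χ : M → ℝ, ContMDiff I 𝓘(ℝ, ℝ) ∞ χ ∧ HasCompactSupport χ ∧ tsupport χ ⊆ U ∧ (∀ x, |χ x - F x| < ε) ∧ ∀ x, g.gradSq χ x ≤ (L + ε) ^ 2 := by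
  intro E _ _ _ H _ I _ M _ _ _ _ _ _ g hg F hFc hFs L hL hF U hU hFU ε hε
  exact exists_contMDiff_approx_of_hasCompactSupport g hg hFc hFs hL hF hU hFU hε

end Summit.SmoothPoincare4.SmoothPoincare4.Theorems.NoncompactShrinkerGapNoncollapsing

end
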